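import Mathlib
import HarnessLib
import Literature.Combinatorics.Additive.Pollard
import Literature.Combinatorics.Additive.Kneser
import Literature.Combinatorics.Additive.GrynkiewiczPollardRep
import Literature.Combinatorics.Additive.GrynkiewiczPollardKneserTools
import Literature.Combinatorics.Additive.GrynkiewiczPollardStepOne
import Literature.Combinatorics.Additive.GrynkiewiczPollardStepTwo
import Literature.Combinatorics.Additive.GrynkiewiczPollardDyson
import Literature.Combinatorics.Additive.GrynkiewiczPollardStepFourA

/-!
# Grynkiewicz's extension of Pollard's theorem — port, part IX: STEP 4, Case 4.2

Topic: `Literature/Combinatorics/Additive`.  Ninth file of the port of [Gry10] Theorem 1.1 / 1.2.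
Case 4.2 of [Gry10] §2: the Dyson pair `(U, I) = (A ∪ B, A ∩ B)` satisfies `U +_t I = U + I` (structure with
`l = 0`), `H = stab(U + I)` with `|H| ≥ ρ + 2t − 1`, the maximal-translate property holds for `B`, and the
Pollard bound fails for `(A, B)`.  Then `Goal t c A B`: after making `I` `H`-periodic (the insertion device),
the `H`-cosets meeting both `A ∖ B` and `B ∖ A` carry translates `C_j` and blocks `D_j` with
`C_j − D_j + D_i ⊆ C_i`; the three sub-cases 4.2.1–4.2.3 of the paper follow (in 4.2.2 the printed `D_k` is
read as `D_j`, the only reading consistent with the surrounding argument).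

The main theorem is stated as `case42_of_le` under the weaker stabilizer hypothesis `|H| ≥ ρ + t + 1` (what
STEP 1 delivers) — the printed argument never uses more — with the printed form `case42` (`|H| ≥ ρ + 2t − 1`)
as a one-line corollary; the weak form is Case 3 of the proof of Grynkiewicz–Wang 2026, Theorem 1.8
(arXiv:2601.17922: «a verbatim copy of Case 2 in the proof of Theorem 1.7 presented in [Gry2]»).

## References
* D. J. Grynkiewicz, *On extending Pollard's theorem for t-representable sums*, Israel J. Math. 177 (2010)
  413–439 (arXiv:0803.2601), §2 Case 4.2 [cite: Grynkiewicz2010, Thm 1.1].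
-/

namespace Literature.Combinatorics.Additive

namespace Grynkiewicz

open Finset Pollard
open scoped Pointwise

variable {G : Type*} [AddCommGroup G] [DecidableEq G]

section Case42Tools

variable {t : ℕ} {A B : Finset G}

/-- A sumset `C + D` of two sets each inside one coset of `H = stab(S)` lies in one `H`-coset; if it meets an
`H`-periodic set `P` it is contained in `P`. [cite: Grynkiewicz2010, §2 Case 4.2] -/
theorem add_subset_of_not_disjoint {S C D P : Finset G} {β β' : G} (hC : C ⊆ β +ᵥ S.addStab)
    (hD : D ⊆ β' +ᵥ S.addStab) (hP : P + S.addStab = P) (h : ¬ Disjoint (C + D) P) : C + D ⊆ P := by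
  obtain ⟨w₀, hw₀, hw₀P⟩ := not_disjoint_iff.1 h
  obtain ⟨c₀, hc₀, d₀, hd₀, rfl⟩ := mem_add.1 hw₀
  intro w hw
  obtain ⟨c, hc, d, hd, rfl⟩ := mem_add.1 hw
  refine mem_of_periodic_of_sub_mem hP hw₀P ?_
  have h1 := sub_mem_addStab (mem_coset_iff.1 (hC hc)) (mem_coset_iff.1 (hC hc₀))
  have h2 := sub_mem_addStab (mem_coset_iff.1 (hD hd)) (mem_coset_iff.1 (hD hd₀))
  have e : c + d - (c₀ + d₀) = (c - β - (c₀ - β)) + (d - β' - (d₀ - β')) := by abel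
  rw [e]; exact add_mem_addStab h1 h2

/-- `N_t(A,B) ≥ t |U + I| + Σ_{w ∈ E} min(t, r_{A,B}(w))` for a `t`-popular `U + I ⊆ A + B` and a set of sums
`E ⊆ A + B` disjoint from `U + I`. [cite: Grynkiewicz2010, §2 Case 4.2] -/
theorem NS_ge_popular_add_sum {P E : Finset G} (hP : P ⊆ A + B) (hpop : ∀ w ∈ P, t ≤ rep A B w)
    (hE : E ⊆ A + B) (hdisj : Disjoint E P) :
    t * P.card + ∑ w ∈ E, min t (rep A B w) ≤ NS t A B := by
  unfold NS
  have h1 : t * P.card ≤ ∑ w ∈ P, min t (rep A B w) := by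
    rw [mul_comm, card_eq_sum_ones, sum_mul]
    exact sum_le_sum fun w hw => by rw [one_mul]; exact le_min le_rfl (hpop w hw)
  calc t * P.card + ∑ w ∈ E, min t (rep A B w)
      ≤ ∑ w ∈ P, min t (rep A B w) + ∑ w ∈ E, min t (rep A B w) := Nat.add_le_add_right h1 _
    _ = ∑ w ∈ P ∪ E, min t (rep A B w) := (sum_union hdisj.symm).symm
    _ ≤ ∑ w ∈ A + B, min t (rep A B w) :=
        sum_le_sum_of_subset_of_nonneg (union_subset hP hE) fun _ _ _ => Nat.zero_le _

/-- Arithmetic of sub-case 4.2.3 (a). [cite: Grynkiewicz2010, §2 Case 4.2] -/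
theorem case423a_arith {t C D un pop ab N Hc ρ UI : ℕ} (ht : 1 ≤ t) (hD : D + 1 ≤ t) (hun : un + 1 ≤ t)
    (hC : pop + un = C) (hgood : t * UI + t * Hc = t * ab + t * ρ) (hρ : Hc ≤ C + D + ρ)
    (hN : t * UI + (t * pop + D * un) ≤ N) (hW : N + t * t < t * ab) : False := by
  subst hC
  obtain ⟨q, rfl⟩ : ∃ q, t = D + q + 1 := ⟨t - D - 1, by omega⟩
  have h1 := Nat.mul_le_mul_left (D + q + 1) hρ
  nlinarith [h1, hgood, hN, hW, hun]

/-- Arithmetic of sub-case 4.2.3 (b). [cite: Grynkiewicz2010, §2 Case 4.2] -/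
theorem case423b_arith {t C D ab N Hc ρ UI : ℕ} (hD : D + 1 ≤ t) (hC : C + 1 ≤ t)
    (hgood : t * UI + t * Hc = t * ab + t * ρ) (hρ : Hc ≤ C + D + ρ)
    (hN : t * UI + C * D ≤ N) (hW : N + t * t < t * ab) : False := by
  obtain ⟨q, rfl⟩ : ∃ q, t = D + q + 1 := ⟨t - D - 1, by omega⟩
  obtain ⟨p, hp⟩ : ∃ p, D + q + 1 = C + p + 1 := ⟨D + q - C, by omega⟩
  have h1 := Nat.mul_le_mul_left (D + q + 1) hρ
  have h2 : (q + 1) * (p + 1) ≥ 1 := Nat.one_le_iff_ne_zero.2 (by positivity)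
  nlinarith [h1, hgood, hN, hW, h2, hp]

/-- Arithmetic of sub-case 4.2.2. [cite: Grynkiewicz2010, §2 Case 4.2] -/
theorem case422_arith {t X un pop ab N Hc ρ UI : ℕ} (ht : 1 ≤ t) (hun : un + 1 ≤ t)
    (hX : pop + un = X) (hgood : t * UI + t * Hc = t * ab + t * ρ) (hρ : Hc ≤ X + ρ)
    (hN : t * UI + (t * pop + un) ≤ N) (hW : N + t * t < t * ab) : False := by
  subst hX
  obtain ⟨q, rfl⟩ : ∃ q, t = un + q + 1 := ⟨t - un - 1, by omega⟩
  have h1 := Nat.mul_le_mul_left (un + q + 1) hρ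
  nlinarith [h1, hgood, hN, hW]

end Case42Tools

/-! ### Case 4.2 -/

section Case42

variable {t c : ℕ} {A B : Finset G}

/-- **[Gry10] §2 Case 4.2, with the stabilizer hypothesis weakened to `|H| ≥ ρ + t + 1`** (the form STEP 1
delivers; the printed Case 4.2 sits under `|H| ≥ ρ + 2t − 1`, but its argument uses only `|H| − ρ ≥ t + 1`).
Let `t ≥ 2`, `t² ≤ c`, `|A| ≥ |B| ≥ t + 1`, the induction hypothesis hold below `(A,B)`; let `I = A ∩ B`,
`U = A ∪ B` with `t ≤ |I| < |B|` and the maximal-translate property (every `z + B` is inside `A` or meets `A`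
in at most `|I|` points); suppose every element of `U + I` has `≥ t` representations in `U + I`, the pair
`(U, I)` is Kneser-tight with `H = stab(U + I)` and `|H| ≥ ρ + t + 1`, and the Pollard bound fails for `(A,B)`.
Then `Goal t c A B`.  (This is also Case 3 of the proof of [GrynkiewiczWang2026, Thm 1.8], «a verbatim copy of
Case 2 of [Gry2]».) [cite: Grynkiewicz2010, §2 Case 4.2] -/
theorem case42_of_le (ht : 2 ≤ t) (hc : t * t ≤ c) (ih : IH t c A B) (hBA : B.card ≤ A.card)
    (hB : t + 1 ≤ B.card) (hIt : t ≤ (A ∩ B).card) (hIB : (A ∩ B).card < B.card)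
    (hmax : ∀ z : G, (A ∩ (z +ᵥ B)).card ≤ (A ∩ B).card ∨ z +ᵥ B ⊆ A)
    (hpopUI : ∀ w ∈ (A ∪ B) + (A ∩ B), t ≤ rep (A ∪ B) (A ∩ B) w)
    (htight : ((A ∪ B) + (A ∩ B)).card + ((A ∪ B) + (A ∩ B)).addStab.card =
      ((A ∪ B) + ((A ∪ B) + (A ∩ B)).addStab).card + ((A ∩ B) + ((A ∪ B) + (A ∩ B)).addStab).card)
    (hHρ : (((A ∪ B) + ((A ∪ B) + (A ∩ B)).addStab).card - (A ∪ B).card) +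
        (((A ∩ B) + ((A ∪ B) + (A ∩ B)).addStab).card - (A ∩ B).card) + (t + 1) ≤
      ((A ∪ B) + (A ∩ B)).addStab.card)
    (hP : NS t A B + c < t * (A.card + B.card)) : Goal t c A B := by
  set U := A ∪ B with hU
  set I := A ∩ B with hI
  set H := (U + I).addStab with hH
  set ρU := (U + H).card - U.card with hρU
  set ρI := (I + H).card - I.card with hρI
  have hA : t + 1 ≤ A.card := hB.trans hBA
  have hAne : A.Nonempty := card_pos.1 (by omega)
  have hBne : B.Nonempty := card_pos.1 (by omega)
  have hIne : I.Nonempty := card_pos.1 (by omega)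
  have hUIne : (U + I).Nonempty := (hAne.mono subset_union_left).add hIne
  have hW : NS t A B + t * t < t * (A.card + B.card) := by omega
  have hperUI : U + I + H = U + I := add_addStab _
  have hrep : ∀ w, rep U I w ≤ rep A B w := rep_union_inter_le A B
  have hsubUI : U + I ⊆ A + B := union_add_inter_subset A B
  have hpopAB : ∀ w ∈ U + I, t ≤ rep A B w := fun w hw => (hpopUI w hw).trans (hrep w)
  have hAU : A ⊆ U := subset_union_left
  have hBU : B ⊆ U := subset_union_right
  have hIA : I ⊆ A := inter_subset_left
  have hIB' : I ⊆ B := inter_subset_right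
  have hρUle : U.card ≤ (U + H).card := card_le_card_add_addStab hUIne U
  have hρIle : I.card ≤ (I + H).card := card_le_card_add_addStab hUIne I
  have hcardUI : U.card + I.card = A.card + B.card := card_union_add_card_inter A B
  -- goodstuff: `t |U + I| + t |H| = t (|A| + |B|) + t ρ`
  have hNSUI : NS t U I = t * (U + I).card := NS_eq_mul_card_add_of_popular hpopUI
  have hNSle : NS t U I ≤ NS t A B := NS_union_inter_le t A B
  have hgood : t * (U + I).card + t * H.card = t * (A.card + B.card) + t * (ρU + ρI) := by
    have : (U + I).card + H.card = A.card + B.card + (ρU + ρI) := by omega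
    rw [← mul_add, this]; ring
  have hHt : t ≤ H.card := by omega
  -- membership helper: sums landing in `U + I`
  have hAI : ∀ a ∈ A, ∀ i ∈ I, ∀ h ∈ H, a + i + h ∈ U + I := fun a ha i hi h hh => by
    rw [← hperUI]; exact add_mem_add (add_mem_add (hAU ha) hi) hh
  have hIBm : ∀ i ∈ I, ∀ b ∈ B, ∀ h ∈ H, i + b + h ∈ U + I := fun i hi b hb h hh => by
    rw [← hperUI, add_comm i b]; exact add_mem_add (add_mem_add (hBU hb) hi) hh
  -- (np) `I` may be assumed `H`-periodic
  by_cases hIper : ∀ α ∈ I + H, α ∈ I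
  swap
  · push Not at hIper
    obtain ⟨α, hαIH, hαI⟩ := hIper
    obtain ⟨i, hi, h, hh, rfl⟩ := mem_add.1 hαIH
    by_cases hαB : i + h ∈ B
    · have hαA : i + h ∉ A := fun hαA => hαI (mem_inter.2 ⟨hαA, hαB⟩)
      refine goal_of_insert_left ht hc ih (by omega) (by omega) hαA fun b hb => hpopAB _ ?_
      rw [show i + h + b = i + b + h by abel]; exact hIBm i hi b hb h hh
    · refine goal_of_insert_right ht hc ih (by omega) (by omega) hαB fun a ha => hpopAB _ ?_
      rw [show a + (i + h) = a + i + h by abel]; exact hAI a ha i hi h hh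
  have hIH : I + H = I := Subset.antisymm (fun α hα => hIper α hα) (subset_add_addStab hUIne I)
  -- cosets of points of `I` lie in `I`
  have hIcos : ∀ i ∈ I, ∀ h ∈ H, i + h ∈ I := fun i hi h hh => by
    rw [← hIH]; exact add_mem_add hi hh
  -- (cue) + the maximal translate: the SHIFT
  have hSHIFT : ∀ c ∈ A, c ∉ B → ∀ d ∈ B, c - d ∈ H → (c - d) +ᵥ B ⊆ A := by
    intro c hcA hcB d hdB hcd
    rcases hmax (c - d) with h | h
    · exfalso
      have hsub : I ⊆ A ∩ ((c - d) +ᵥ B) := fun i hi =>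
        mem_inter_vadd_iff.2 ⟨hIA hi, hIB' (by
          rw [show i - (c - d) = i + -(c - d) by abel]; exact hIcos i hi _ (neg_mem_addStab hcd))⟩
      have hc' : c ∈ A ∩ ((c - d) +ᵥ B) := mem_inter_vadd_iff.2 ⟨hcA, by rw [sub_sub_cancel]; exact hdB⟩
      have hcI : c ∉ I := fun hcI => hcB (hIB' hcI)
      have : I.card < (A ∩ ((c - d) +ᵥ B)).card :=
        card_lt_card ⟨hsub, fun hsup => hcI (hsup hc')⟩
      omega
    · exact h
  -- points of `A ∖ B` and `B ∖ A` never share a coset with `I`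
  have hnotI_A : ∀ a ∈ A, a ∉ B → ∀ x ∈ I, a - x ∉ H := fun a ha haB x hx hh =>
    haB (hIB' (by have := hIcos x hx _ hh; rwa [add_sub_cancel] at this))
  have hnotI_B : ∀ b ∈ B, b ∉ A → ∀ x ∈ I, b - x ∉ H := fun b hb hbA x hx hh =>
    hbA (hIA (by have := hIcos x hx _ hh; rwa [add_sub_cancel] at this))
  -- one-coset hole bound on `U`
  have hhole : ∀ u ∈ U, H.card ≤ (U ∩ (u +ᵥ H)).card + ρU := fun u hu =>
    card_addStab_le_card_inter_coset_add_holes hUIne hu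
  have hUcos : ∀ u : G, (U ∩ (u +ᵥ H)).card ≤ (A ∩ (u +ᵥ H)).card + (B ∩ (u +ᵥ H)).card := fun u => by
    rw [hU, union_inter_distrib_right]; exact card_union_le _ _
  ------------------------------------------------------------------
  -- CLAIM X: a point of `B ∖ A` whose coset misses `A` forces all sums popular
  ------------------------------------------------------------------
  by_cases hB1 : ∃ β ∈ B, β ∉ A ∧ ∀ a ∈ A, a - β ∉ H
  · obtain ⟨β, hβB, hβA, hβfar⟩ := hB1
    have hA0 : ∀ a ∈ A, a ∉ B → ∀ b' ∈ B, b' - a ∉ H := by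
      intro a haA haB b' hb' hh
      have hab : a - b' ∈ H := by rw [← neg_sub]; exact neg_mem_addStab hh
      have hsh := hSHIFT a haA haB b' hb' hab
      refine hβfar _ (hsh (mem_vadd_finset.2 ⟨β, hβB, rfl⟩)) ?_
      rw [vadd_eq_add, show a - b' + β - β = a - b' by abel]; exact hab
    have hB0 : ∀ b' ∈ B, b' ∉ A → ∀ a ∈ A, a - b' ∉ H := by
      intro b' hb'B hb'A a haA hh
      have hba : b' - a ∈ H := by rw [← neg_sub]; exact neg_mem_addStab hh
      have haB : a ∉ B := fun haB => hnotI_B b' hb'B hb'A a (mem_inter.2 ⟨haA, haB⟩) hba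
      exact hA0 a haA haB b' hb'B hba
    refine Or.inr ⟨A, B, Str.of_popular (by omega) fun w hw => ?_⟩
    obtain ⟨a, ha, b, hb, rfl⟩ := mem_add.1 hw
    have hcos := card_inter_coset_add_le_rep_add A B a b (S := U + I)
    rw [← hH] at hcos
    by_cases haB : a ∈ B
    · have haI : a ∈ I := mem_inter.2 ⟨ha, haB⟩
      have hfullA : (A ∩ (a +ᵥ H)).card = H.card := by
        rw [inter_eq_right.2 (fun x hx => ?_), card_coset]
        obtain ⟨h, hh, rfl⟩ := mem_vadd_finset.1 hx
        exact hIA (hIcos a haI h hh)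
      by_cases hbA : b ∈ A
      · have hbI : b ∈ I := mem_inter.2 ⟨hbA, hb⟩
        have hfullB : (B ∩ (b +ᵥ H)).card = H.card := by
          rw [inter_eq_right.2 (fun x hx => ?_), card_coset]
          obtain ⟨h, hh, rfl⟩ := mem_vadd_finset.1 hx
          exact hIB' (hIcos b hbI h hh)
        omega
      · -- `b ∈ B ∖ A`: its coset carries no point of `A`
        have hAb : (A ∩ (b +ᵥ H)).card = 0 := by
          rw [card_eq_zero, ← not_nonempty_iff_eq_empty]
          rintro ⟨x, hx⟩
          rw [mem_inter, mem_coset_iff] at hx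
          exact hB0 b hb hbA x hx.1 hx.2
        have h1 := hhole b (hBU hb)
        have h2 := hUcos b
        omega
    · -- `a ∈ A ∖ B`: its coset carries no point of `B`
      have hBa : (B ∩ (a +ᵥ H)).card = 0 := by
        rw [card_eq_zero, ← not_nonempty_iff_eq_empty]
        rintro ⟨x, hx⟩
        rw [mem_inter, mem_coset_iff] at hx
        exact hA0 a ha haB x hx.1 hx.2
      have h1 := hhole a (hAU ha)
      have h2 := hUcos a
      by_cases hbA : b ∈ A
      · have hbI : b ∈ I := mem_inter.2 ⟨hbA, hb⟩
        have hfullB : (B ∩ (b +ᵥ H)).card = H.card := by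
          rw [inter_eq_right.2 (fun x hx => ?_), card_coset]
          obtain ⟨h, hh, rfl⟩ := mem_vadd_finset.1 hx
          exact hIB' (hIcos b hbI h hh)
        omega
      · have hAb : (A ∩ (b +ᵥ H)).card = 0 := by
          rw [card_eq_zero, ← not_nonempty_iff_eq_empty]
          rintro ⟨x, hx⟩
          rw [mem_inter, mem_coset_iff] at hx
          exact hB0 b hb hbA x hx.1 hx.2
        have hdisj : Disjoint (a +ᵥ H) (b +ᵥ H) := by
          rcases coset_eq_or_disjoint a b (S := U + I) with h | h
          · exfalso
            have : b ∈ a +ᵥ H := by rw [h]; exact mem_coset_self hUIne b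
            exact hA0 a ha haB b hb (mem_coset_iff.1 this)
          · exact h
        have h3 := two_cosets_holes hUIne (hAU ha) (hBU hb) hdisj
        rw [← hH] at h3
        have h4 := hUcos b
        omega
  ------------------------------------------------------------------
  -- MAIN: every point of `B ∖ A` shares its coset with a point of `A` (∖ B)
  ------------------------------------------------------------------
  push Not at hB1
  -- notation: `C β = A ∩ (β + H)`, `D β = B ∩ (β + H)` for `β ∈ B ∖ A`
  have hCne : ∀ β ∈ B, β ∉ A → (A ∩ (β +ᵥ H)).Nonempty := by
    intro β hβ hβA
    obtain ⟨a, ha, hh⟩ := hB1 β hβ hβA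
    exact ⟨a, by rw [mem_inter, mem_coset_iff]; exact ⟨ha, hh⟩⟩
  have hCout : ∀ β ∈ B, β ∉ A → ∀ c ∈ A ∩ (β +ᵥ H), c ∉ B := by
    intro β hβ hβA c hc hcB
    rw [mem_inter, mem_coset_iff] at hc
    exact hnotI_B β hβ hβA c (mem_inter.2 ⟨hc.1, hcB⟩)
      (by rw [← neg_sub]; exact neg_mem_addStab hc.2)
  have hDout : ∀ β ∈ B, β ∉ A → ∀ d ∈ B ∩ (β +ᵥ H), d ∉ A := by
    intro β hβ hβA d hd hdA
    rw [mem_inter, mem_coset_iff] at hd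
    exact hnotI_B β hβ hβA d (mem_inter.2 ⟨hdA, hd.1⟩)
      (by rw [← neg_sub]; exact neg_mem_addStab hd.2)
  have hDself : ∀ β ∈ B, β ∈ B ∩ (β +ᵥ H) := fun β hβ => mem_inter.2 ⟨hβ, mem_coset_self hUIne β⟩
  -- the translates: `(d' - d) + C β ⊆ C β'`
  have htrans : ∀ β ∈ B, β ∉ A → ∀ β' ∈ B, β' ∉ A → ∀ c ∈ A ∩ (β +ᵥ H), ∀ d ∈ B ∩ (β +ᵥ H),
      ∀ d' ∈ B ∩ (β' +ᵥ H), c - d + d' ∈ A ∩ (β' +ᵥ H) := by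
    intro β hβ hβA β' hβ' _ c hc d hd d' hd'
    have hcd : c - d ∈ H := by
      have := sub_mem_addStab (mem_coset_iff.1 (mem_inter.1 hc).2) (mem_coset_iff.1 (mem_inter.1 hd).2)
      rwa [sub_sub_sub_cancel_right] at this
    have hsh := hSHIFT c (mem_inter.1 hc).1 (hCout β hβ hβA c hc) d (mem_inter.1 hd).1 hcd
    refine mem_inter.2 ⟨hsh (mem_vadd_finset.2 ⟨d', (mem_inter.1 hd').1, rfl⟩), mem_coset_iff.2 ?_⟩
    have e : c - d + d' - β' = (c - d) + (d' - β') := by abel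
    rw [e]; exact add_mem_addStab hcd (mem_coset_iff.1 (mem_inter.1 hd').2)
  have hCcard : ∀ β ∈ B, β ∉ A → ∀ β' ∈ B, β' ∉ A →
      (A ∩ (β +ᵥ H)).card ≤ (A ∩ (β' +ᵥ H)).card := by
    intro β hβ hβA β' hβ' hβ'A
    have hinj : Set.InjOn (fun c => c - β + β') ↑(A ∩ (β +ᵥ H)) := fun c _ c' _ e => by
      simpa using e
    rw [← card_image_of_injOn hinj]
    exact card_le_card fun x hx => by
      obtain ⟨c, hc, rfl⟩ := mem_image.1 hx
      exact htrans β hβ hβA β' hβ' hβ'A c hc β (hDself β hβ) β' (hDself β' hβ')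
  -- (F2) `r_{A,B}(c + d') ≥ |D β'|` for `c ∈ C β`, `d' ∈ D β'`
  have hF2 : ∀ β ∈ B, β ∉ A → ∀ β' ∈ B, β' ∉ A → ∀ c ∈ A ∩ (β +ᵥ H), ∀ d' ∈ B ∩ (β' +ᵥ H),
      (B ∩ (β' +ᵥ H)).card ≤ rep A B (c + d') := by
    intro β hβ hβA β' hβ' hβ'A c hc d' hd'
    rw [rep_eq_card_filter_right]
    refine card_le_card fun d'' hd'' => mem_filter.2 ⟨(mem_inter.1 hd'').1, ?_⟩
    -- `c + d' - d'' = (c' - d'') + β` with `c' = c - β + d' ∈ C β'`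
    have hc' := htrans β hβ hβA β' hβ' hβ'A c hc β (hDself β hβ) d' hd'
    have hc'd : c - β + d' - d'' ∈ H := by
      have := sub_mem_addStab (mem_coset_iff.1 (mem_inter.1 hc').2) (mem_coset_iff.1 (mem_inter.1 hd'').2)
      rwa [sub_sub_sub_cancel_right] at this
    have hsh := hSHIFT _ (mem_inter.1 hc').1 (hCout β' hβ' hβ'A _ hc') d'' (mem_inter.1 hd'').1 hc'd
    have := hsh (mem_vadd_finset.2 ⟨β, hβ, rfl⟩)
    rw [vadd_eq_add, show c - β + d' - d'' + β = c + d' - d'' by abel] at this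
    exact this
  -- hole bounds
  have hρ1 : ∀ β ∈ B, β ∉ A → H.card ≤ (A ∩ (β +ᵥ H)).card + (B ∩ (β +ᵥ H)).card + ρU := fun β hβ _ => by
    have h1 := hhole β (hBU hβ); have h2 := hUcos β; omega
  have hρ2 : ∀ α ∈ A, (∀ b ∈ B, b - α ∉ H) → H.card ≤ (A ∩ (α +ᵥ H)).card + ρU := by
    intro α hα hfar
    have hBa : (B ∩ (α +ᵥ H)).card = 0 := by
      rw [card_eq_zero, ← not_nonempty_iff_eq_empty]
      rintro ⟨x, hx⟩
      rw [mem_inter, mem_coset_iff] at hx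
      exact hfar x hx.1 hx.2
    have h1 := hhole α (hAU hα); have h2 := hUcos α; omega
  -- (F3) the insertion alternative for a coset `β`
  have hF3 : ∀ β ∈ B, β ∉ A → (∀ β' ∈ B, β' ∉ A →
      ¬ Disjoint (A ∩ (β +ᵥ H) + B ∩ (β' +ᵥ H)) (U + I)) → Goal t c A B := by
    intro β hβ hβA hall
    obtain ⟨c₀, hc₀⟩ := hCne β hβ hβA
    have hβc : β - c₀ ∈ H := by
      rw [← neg_sub]; exact neg_mem_addStab (mem_coset_iff.1 (mem_inter.1 hc₀).2)
    refine goal_of_insert_left ht hc ih (by omega) (by omega) hβA fun b hb => hpopAB _ ?_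
    by_cases hbA : b ∈ A
    · -- `β + b = (c₀ + b) + (β - c₀)` with `b ∈ I`
      rw [show β + b = c₀ + b + (β - c₀) by abel]
      exact hAI c₀ (mem_inter.1 hc₀).1 b (mem_inter.2 ⟨hbA, hb⟩) _ hβc
    · have hsub := add_subset_of_not_disjoint (inter_subset_right : A ∩ (β +ᵥ H) ⊆ _)
        (inter_subset_right : B ∩ (b +ᵥ H) ⊆ _) hperUI (hall b hb hbA)
      rw [show β + b = c₀ + b + (β - c₀) by abel, ← hperUI]
      exact add_mem_add (hsub (add_mem_add hc₀ (hDself b hb))) hβc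
  ------------------------------------------------------------------
  -- SUBCASE 4.2.3
  ------------------------------------------------------------------
  by_cases h423 : ∃ β ∈ B, β ∉ A ∧ ∃ β' ∈ B, β' ∉ A ∧
      Disjoint (A ∩ (β +ᵥ H) + B ∩ (β' +ᵥ H)) (U + I) ∧ (B ∩ (β' +ᵥ H)).card + 1 ≤ t
  · obtain ⟨β, hβ, hβA, β', hβ', hβ'A, hdisj, hDt⟩ := h423
    set C := A ∩ (β +ᵥ H) with hCdef
    set D := B ∩ (β' +ᵥ H) with hDdef
    have hCA : C ⊆ A := inter_subset_left
    have hDB : D ⊆ B := inter_subset_left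
    have hCDsub : C + D ⊆ A + B := add_subset_add hCA hDB
    have hρ' := hρ1 β' hβ' hβ'A
    have hCC := hCcard β' hβ' hβ'A β hβ hβA
    by_cases hCt : t ≤ C.card
    · -- (a) `|C| ≥ t`: the row of `β'`
      by_cases hrow : t ≤ (A.filter (fun a => rep A B (a + β') ≤ t)).card
      · exact goal_of_row (by omega) hc ih hA hB hβ' hrow
      rw [not_le] at hrow
      exfalso
      set E := C.image (· + β') with hE
      have hEsub : E ⊆ A + B := fun w hw => by
        obtain ⟨x, hx, rfl⟩ := mem_image.1 hw; exact add_mem_add (hCA hx) hβ'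
      have hECD : E ⊆ C + D := fun w hw => by
        obtain ⟨x, hx, rfl⟩ := mem_image.1 hw; exact add_mem_add hx (hDself β' hβ')
      have hEdisj : Disjoint E (U + I) := hdisj.mono_left hECD
      have hN := NS_ge_popular_add_sum hsubUI hpopAB hEsub hEdisj
      rw [hE, sum_image (fun x _ y _ e => add_right_cancel e)] at hN
      -- split `C` into popular / unpopular partners of `β'`
      set un := (C.filter (fun x => rep A B (x + β') ≤ t)).card with hun
      set pop := (C.filter (fun x => ¬ rep A B (x + β') ≤ t)).card with hpop
      have hsplit : pop + un = C.card := by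
        rw [hun, hpop, add_comm]; exact card_filter_add_card_filter_not (s := C) _
      have hunle : un + 1 ≤ t := by
        have : C.filter (fun x => rep A B (x + β') ≤ t) ⊆ A.filter (fun a => rep A B (a + β') ≤ t) :=
          filter_subset_filter _ hCA
        have := card_le_card this
        omega
      have hsum2 : t * pop ≤ ∑ x ∈ C.filter (fun x => ¬ rep A B (x + β') ≤ t), min t (rep A B (x + β')) := by
        rw [hpop, mul_comm, card_eq_sum_ones, sum_mul]
        refine sum_le_sum fun x hx => ?_
        rw [one_mul]; exact le_min le_rfl (not_le.1 (mem_filter.1 hx).2).le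
      have hsum1 : D.card * un ≤ ∑ x ∈ C.filter (fun x => rep A B (x + β') ≤ t), min t (rep A B (x + β')) := by
        rw [hun, mul_comm, card_eq_sum_ones, sum_mul]
        refine sum_le_sum fun x hx => ?_
        rw [one_mul]
        exact le_min (by omega) (hF2 β hβ hβA β' hβ' hβ'A x (mem_filter.1 hx).1 β' (hDself β' hβ'))
      have hsum : t * pop + D.card * un ≤ ∑ x ∈ C, min t (rep A B (x + β')) := by
        rw [← sum_filter_add_sum_filter_not C (fun x => rep A B (x + β') ≤ t)]; omega
      have hρfin : H.card ≤ C.card + D.card + (ρU + ρI) := by rw [hCdef, hDdef]; omega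
      exact case423a_arith (by omega) hDt hunle hsplit hgood hρfin (le_trans (Nat.add_le_add_left hsum _) hN) hW
    · -- (b) `|C| ≤ t - 1`
      rw [not_le] at hCt
      exfalso
      have hN := NS_ge_popular_add_sum hsubUI hpopAB hCDsub hdisj
      have hNCD : NS t C D ≤ ∑ w ∈ C + D, min t (rep A B w) :=
        sum_le_sum fun w _ => min_le_min_left _ (rep_mono hCA hDB w)
      rw [NS_eq_card_mul_card C (by omega : D.card ≤ t)] at hNCD
      have hρfin : H.card ≤ C.card + D.card + (ρU + ρI) := by rw [hCdef, hDdef]; omega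
      exact case423b_arith hDt (by omega) hgood hρfin (le_trans (Nat.add_le_add_left hNCD _) hN) hW
  -- ¬ 4.2.3: a disjoint block pair has `|D| ≥ t`
  have h423' : ∀ β ∈ B, β ∉ A → ∀ β' ∈ B, β' ∉ A →
      Disjoint (A ∩ (β +ᵥ H) + B ∩ (β' +ᵥ H)) (U + I) → t ≤ (B ∩ (β' +ᵥ H)).card := by
    intro β hβ hβA β' hβ' hβ'A hd
    by_contra hlt
    exact h423 ⟨β, hβ, hβA, β', hβ', hβ'A, hd, by omega⟩
  ------------------------------------------------------------------
  -- SUBCASE 4.2.1: all blocks `D` are large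
  ------------------------------------------------------------------
  by_cases h421 : ∀ β' ∈ B, β' ∉ A → t ≤ (B ∩ (β' +ᵥ H)).card
  · by_cases hX : ∃ α ∈ A, (∀ b ∈ B, b - α ∉ H) ∧ ∃ β' ∈ B, β' ∉ A ∧
        Disjoint (A ∩ (α +ᵥ H) + B ∩ (β' +ᵥ H)) (U + I)
    · obtain ⟨α, hα, hfar, β', hβ', hβ'A, hdisj⟩ := hX
      exfalso
      set X := A ∩ (α +ᵥ H) with hXdef
      set D := B ∩ (β' +ᵥ H) with hDdef
      have hXA : X ⊆ A := inter_subset_left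
      have hDB : D ⊆ B := inter_subset_left
      have hN := NS_ge_popular_add_sum hsubUI hpopAB (add_subset_add hXA hDB) hdisj
      have hNXD : NS t X D ≤ ∑ w ∈ X + D, min t (rep A B w) :=
        sum_le_sum fun w _ => min_le_min_left _ (rep_mono hXA hDB w)
      have hX1 : t * X.card ≤ NS t X D := mul_card_le_NS X (h421 β' hβ' hβ'A)
      have hρ := hρ2 α hα hfar
      rw [← hXdef] at hρ
      have h1 := Nat.mul_le_mul_left t hρ
      rw [mul_add] at h1
      have hgood' : t * (U + I).card + t * H.card = t * (A.card + B.card) + t * ρU + t * ρI := by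
        rw [hgood]; ring
      omega
    · -- every sum is `t`-popular
      push Not at hX
      refine Or.inr ⟨A, B, Str.of_popular (by omega) fun w hw => ?_⟩
      obtain ⟨a, ha, b, hb, rfl⟩ := mem_add.1 hw
      by_cases hbA : b ∈ A
      · refine hpopAB _ ?_
        have := hAI a ha b (mem_inter.2 ⟨hbA, hb⟩) 0 (zero_mem_addStab' hUIne)
        rwa [add_zero] at this
      by_cases haB : a ∈ B
      · refine hpopAB _ ?_
        have := hIBm a (mem_inter.2 ⟨ha, haB⟩) b hb 0 (zero_mem_addStab' hUIne)
        rwa [add_zero] at this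
      by_cases hcos : ∃ b'' ∈ B, b'' - a ∈ H
      · obtain ⟨b'', hb'', hh⟩ := hcos
        have hb''A : b'' ∉ A := fun hb''A =>
          hnotI_A a ha haB b'' (mem_inter.2 ⟨hb''A, hb''⟩) (by rw [← neg_sub]; exact neg_mem_addStab hh)
        have haC : a ∈ A ∩ (b'' +ᵥ H) := by
          rw [mem_inter, mem_coset_iff, ← neg_sub]; exact ⟨ha, neg_mem_addStab hh⟩
        exact (h421 b hb hbA).trans (hF2 b'' hb'' hb''A b hb hbA a haC b (hDself b hb))
      · push Not at hcos
        have hsub := add_subset_of_not_disjoint (inter_subset_right : A ∩ (a +ᵥ H) ⊆ _)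
          (inter_subset_right : B ∩ (b +ᵥ H) ⊆ _) hperUI (hX a ha hcos b hb hbA)
        exact hpopAB _ (hsub (add_mem_add (mem_inter.2 ⟨ha, mem_coset_self hUIne a⟩) (hDself b hb)))
  ------------------------------------------------------------------
  -- SUBCASE 4.2.2: a small block `D β₀`
  ------------------------------------------------------------------
  push Not at h421
  obtain ⟨β₀, hβ₀, hβ₀A, hD₀t⟩ := h421
  set D₀ := B ∩ (β₀ +ᵥ H) with hD₀def
  have hD₀B : D₀ ⊆ B := inter_subset_left
  -- every `C β + D β₀` lies inside `U + I`
  have hCD₀ : ∀ β ∈ B, β ∉ A → A ∩ (β +ᵥ H) + D₀ ⊆ U + I := by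
    intro β hβ hβA
    refine add_subset_of_not_disjoint (inter_subset_right : A ∩ (β +ᵥ H) ⊆ _)
      (inter_subset_right : D₀ ⊆ _) hperUI fun hd => ?_
    have h' : t ≤ D₀.card := h423' β hβ hβA β₀ hβ₀ hβ₀A hd
    omega
  by_cases hX2 : ∃ α ∈ A, (∀ b ∈ B, b - α ∉ H) ∧ Disjoint (A ∩ (α +ᵥ H) + D₀) (U + I)
  · obtain ⟨α, hα, hfar, hdisj⟩ := hX2
    set X := A ∩ (α +ᵥ H) with hXdef
    have hXA : X ⊆ A := inter_subset_left
    have hρ := hρ2 α hα hfar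
    -- the row of `β₀`
    by_cases hrow : t ≤ (A.filter (fun a => rep A B (a + β₀) ≤ t)).card
    · exact goal_of_row (by omega) hc ih hA hB hβ₀ hrow
    rw [not_le] at hrow
    exfalso
    set E := X.image (· + β₀) with hE
    have hEsub : E ⊆ A + B := fun w hw => by
      obtain ⟨x, hx, rfl⟩ := mem_image.1 hw; exact add_mem_add (hXA hx) hβ₀
    have hEXD : E ⊆ X + D₀ := fun w hw => by
      obtain ⟨x, hx, rfl⟩ := mem_image.1 hw; exact add_mem_add hx (hDself β₀ hβ₀)
    have hN := NS_ge_popular_add_sum hsubUI hpopAB hEsub (hdisj.mono_left hEXD)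
    rw [hE, sum_image (fun x _ y _ e => add_right_cancel e)] at hN
    set un := (X.filter (fun x => rep A B (x + β₀) ≤ t)).card with hun
    set pop := (X.filter (fun x => ¬ rep A B (x + β₀) ≤ t)).card with hpop
    have hsplit : pop + un = X.card := by
      rw [hun, hpop, add_comm]; exact card_filter_add_card_filter_not (s := X) _
    have hunle : un + 1 ≤ t := by
      have : X.filter (fun x => rep A B (x + β₀) ≤ t) ⊆ A.filter (fun a => rep A B (a + β₀) ≤ t) :=
        filter_subset_filter _ hXA
      have := card_le_card this
      omega
    have hsum2 : t * pop ≤ ∑ x ∈ X.filter (fun x => ¬ rep A B (x + β₀) ≤ t), min t (rep A B (x + β₀)) := by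
      rw [hpop, mul_comm, card_eq_sum_ones, sum_mul]
      refine sum_le_sum fun x hx => ?_
      rw [one_mul]; exact le_min le_rfl (not_le.1 (mem_filter.1 hx).2).le
    have hsum1 : un ≤ ∑ x ∈ X.filter (fun x => rep A B (x + β₀) ≤ t), min t (rep A B (x + β₀)) := by
      rw [hun, card_eq_sum_ones]
      exact sum_le_sum fun x hx => le_min (by omega) (one_le_rep_add (hXA (mem_filter.1 hx).1) hβ₀)
    have hsum : t * pop + un ≤ ∑ x ∈ X, min t (rep A B (x + β₀)) := by
      rw [← sum_filter_add_sum_filter_not X (fun x => rep A B (x + β₀) ≤ t)]; omega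
    have hρfin : H.card ≤ X.card + (ρU + ρI) := by rw [hXdef]; omega
    exact case422_arith (by omega) hunle hsplit hgood hρfin (le_trans (Nat.add_le_add_left hsum _) hN) hW
  · -- insertion of a point `γ ∈ C β₀` on the right
    push Not at hX2
    obtain ⟨γ, hγ⟩ := hCne β₀ hβ₀ hβ₀A
    have hγB : γ ∉ B := hCout β₀ hβ₀ hβ₀A γ hγ
    have hγβ : γ - β₀ ∈ H := mem_coset_iff.1 (mem_inter.1 hγ).2
    refine goal_of_insert_right ht hc ih (by omega) (by omega) hγB fun a ha => hpopAB _ ?_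
    rw [show a + γ = a + β₀ + (γ - β₀) by abel]
    by_cases haB : a ∈ B
    · exact hIBm a (mem_inter.2 ⟨ha, haB⟩) β₀ hβ₀ _ hγβ
    rw [← hperUI]
    refine add_mem_add ?_ hγβ
    by_cases hcos : ∃ b'' ∈ B, b'' - a ∈ H
    · obtain ⟨b'', hb'', hh⟩ := hcos
      have hb''A : b'' ∉ A := fun hb''A =>
        hnotI_A a ha haB b'' (mem_inter.2 ⟨hb''A, hb''⟩) (by rw [← neg_sub]; exact neg_mem_addStab hh)
      have haC : a ∈ A ∩ (b'' +ᵥ H) := by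
        rw [mem_inter, mem_coset_iff, ← neg_sub]; exact ⟨ha, neg_mem_addStab hh⟩
      exact hCD₀ b'' hb'' hb''A (add_mem_add haC (hDself β₀ hβ₀))
    · push Not at hcos
      have hsub := add_subset_of_not_disjoint (inter_subset_right : A ∩ (a +ᵥ H) ⊆ _)
        (inter_subset_right : D₀ ⊆ _) hperUI (hX2 a ha hcos)
      exact hsub (add_mem_add (mem_inter.2 ⟨ha, mem_coset_self hUIne a⟩) (hDself β₀ hβ₀))

/-- **[Gry10] §2 Case 4.2** as printed (`|H| ≥ ρ + 2t − 1`): a special case of `case42_of_le`.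
[cite: Grynkiewicz2010, §2 Case 4.2] -/
theorem case42 (ht : 2 ≤ t) (hc : t * t ≤ c) (ih : IH t c A B) (hBA : B.card ≤ A.card)
    (hB : t + 1 ≤ B.card) (hIt : t ≤ (A ∩ B).card) (hIB : (A ∩ B).card < B.card)
    (hmax : ∀ z : G, (A ∩ (z +ᵥ B)).card ≤ (A ∩ B).card ∨ z +ᵥ B ⊆ A)
    (hpopUI : ∀ w ∈ (A ∪ B) + (A ∩ B), t ≤ rep (A ∪ B) (A ∩ B) w)
    (htight : ((A ∪ B) + (A ∩ B)).card + ((A ∪ B) + (A ∩ B)).addStab.card =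
      ((A ∪ B) + ((A ∪ B) + (A ∩ B)).addStab).card + ((A ∩ B) + ((A ∪ B) + (A ∩ B)).addStab).card)
    (hHρ : (((A ∪ B) + ((A ∪ B) + (A ∩ B)).addStab).card - (A ∪ B).card) +
        (((A ∩ B) + ((A ∪ B) + (A ∩ B)).addStab).card - (A ∩ B).card) + 2 * t ≤
      ((A ∪ B) + (A ∩ B)).addStab.card + 1)
    (hP : NS t A B + c < t * (A.card + B.card)) : Goal t c A B :=
  case42_of_le ht hc ih hBA hB hIt hIB hmax hpopUI htight (by omega) hP

end Case42

end Grynkiewicz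

end Literature.Combinatorics.Additive
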